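/-
Copyright (c) 2026 the pub-hodgecm-mathlib formalisation cell (harness21).  Prover seat hodgecm-mathlib-K2E3-p26 (g0), Track B «K2-LIT» ∕ h413
(`stmt-HodgeConjecture-24833`), line `K2_E3_EllipticInputs`, (SC-an)₂ road «FC₂» (dealer K2E3-plan (g4) L4 EMIT #1, deal D134), letter COLL₂ of the assembly
`Theorems/K2E3FinConjAssemblyTwo.lean` ∕ `…SupercuspidalTruncatedCharAnalyticTwoOfLetters.lean` (K2E3-p23 (g7)) — FILE A of two ((6a₂) + the root involution).  2026-09-04.
-/
import Summits.HodgeConjecture.HodgeConjecture.Theorems.K2E3NearTriangularEigenvalues           -- ★ (FC-6a) `exists_isRoot_of_v_eval_lt_sq` (strong Hensel, `Valued.v` currency), `v_inv_pow_uniformizer`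
import Literature.NumberTheory.Automorphic.UnitaryTwoCartanAnyInvolution                        -- ★ `Two.rel00 ∕ rel01 ∕ rel10 ∕ rel11`, `Two.inv_apply_of_mem`
import HarnessLib

/-!
# Crux `H413` — K2-LIT E3, (SC-an)₂ road «FC₂», letter COLL₂ = brick (FC-6₂), FILE A: TWO `K`-RATIONAL EIGENVALUES OF A NEAR-LOWER-TRIANGULAR UNITARY `2 × 2` MATRIX,
# AND THE ROOT INVOLUTION `λ ↦ σ(λ)⁻¹` ON THEM

Cell `hodgecm-mathlib`, Track B, line `K2_E3_EllipticInputs`, PART «SC» socket (SC-an)₂ `sig_K2E3SupercuspidalTruncatedCharAnalyticTwo` via the in-house road «FC₂»; seat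
K2E3-p26 (g0), dealer K2E3-plan (g4) deal D134, binder desk K2E3-p23 (g7).  THEOREMS ONLY (no `def`, no `instance`, no notation, no named-fact hypothesis, no `sorry`);
count-neutral helper (`--supports stmt-HodgeConjecture-24833 --as helper`).  The `Fin 2` twin of ★ (FC-6a) `K2E3NearTriangularEigenvalues` (K2E5-p01 (g4); cubic, `Fin 3`-typed),
written directly for the quadratic and reusing that file's generic strong-Hensel wrapper; consumed by FILE B `Theorems/K2E3BoxCompactCentralizerCollisionTwo.lean` (the box lemma).

THE MATHEMATICS (`K` non-archimedean local with `Valued K ℤᵐ⁰`, `σ : K → K` a ring endomorphism, `ϖ` a uniformiser).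
* §1 (6a₂) **an eigenvalue near `a`**: for `a, b, c, e ∈ K` with `v(a), v(c), v(e) ≤ exp M`, `v(b) ≤ exp(M − 2d)`, `v(a − e) ≥ exp(−k)`, `M + k < d`, strong Hensel (★
  `exists_isRoot_of_v_eval_lt_sq`) for the rescaled INTEGRAL quadratic `f = X² − (a′+e′)X + (a′e′ − b′c′)` (`x′ = ϖ^M x`) at `a′` — `f(a′) = −b′c′` has valuation
  `≤ exp(−2d)`, `f′(a′) = a′ − e′` has valuation `≥ exp(−M−k)` — gives `λ₀ ∈ K` with `(λ₀ − a)(λ₀ − e) = bc` (a root of `χ = X² − (a+e)X + (ae − bc)`, the characteristic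
  polynomial of `[[a,b],[c,e]]`) and `v(λ₀ − a) ≤ exp(2M + k − 2d)`; the other root is `a + e − λ₀`.
* §2 **the root involution at `2 × 2`**: for `g ∈ U(σ, Φ₂)(K)` with matrix `A = [[a,b],[c,e]]`, unitarity gives `σ(tr A)·det A = tr A` and `σ(det A)·det A = 1` (the
  four relations `ᵗ(σA)Φ₂A = Φ₂`, ★ `Two.rel00–rel11`, and the four relations `A·A⁻¹ = 1` with `(A⁻¹)ᵢⱼ = σ(A_{1−j,1−i})`, ★ `Two.inv_apply_of_mem`), whence for a root
  `λ₀` of `χ`: `(σ(λ₀)λ₀ − 1)(σ(λ₀)(a + e − λ₀) − 1) = 0` — `σ(λ₀)` is a root of `χ^σ = χ_{A⁻¹}`, whose roots are the inverses of those of `χ`.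

HONEST LABEL: HC_CM is proved only modulo the 7 printed citations (2 remaining named inputs: hLiu418 = stmt-HodgeConjecture-24832, h413 =
stmt-HodgeConjecture-24833) until rung 0 closes; count-neutral; (SC-an)₂ is NOT ★.

## References
* [Rogawski1990] J. D. Rogawski, *Automorphic Representations of Unitary Groups in Three Variables*, Ann. of Math. Stud. 123 (1990), §1.9–§1.10 pp. 8–9, §3.5 p. 29.
* [NeukirchANT1999] J. Neukirch, *Algebraic Number Theory* (1999), Ch. II §4 Lemma (4.6) (Hensel).
* [HarishChandra1970] Harish-Chandra (notes by G. van Dijk), *Harmonic Analysis on Reductive p-adic Groups*, LNM 162 (1970), Part VI §8 p. 60.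
-/

set_option autoImplicit false
-- the mandated namespace repeats `HodgeConjecture.HodgeConjecture`, as in every `Theorems/*.lean` of this sub-problem
set_option linter.dupNamespace false

noncomputable section

open Matrix Polynomial
open scoped MatrixGroups WithZero
open Literature.NumberTheory.Automorphic Literature.NumberTheory.Automorphic.UnitaryGroup
open Summit.HodgeConjecture.HodgeConjecture.Cruxes.H413.K2E3NearTriangularEigenvalues

namespace Summit.HodgeConjecture.HodgeConjecture.Cruxes.H413.K2E3NearTriangularEigenvaluesTwo

/-! ## §1 (6a₂) Strong Hensel for the rescaled quadratic: an eigenvalue near `a` -/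

section Hensel

variable {K : Type*} [Field K] [Valued K ℤᵐ⁰] [ValuativeRel K] [(Valued.v : Valuation K ℤᵐ⁰).Compatible] [IsNonarchimedeanLocalField K]

/-- **(6a₂) AN EIGENVALUE NEAR `a`.**  For `a, b, c, e ∈ K` with `v(a), v(c), v(e) ≤ exp M`, `v(b) ≤ exp(M − 2d)`, `v(a − e) ≥ exp(−k)` and `M + k < d` there is `λ₀ ∈ K` with
`(λ₀ − a)(λ₀ − e) = bc` (a root of `X² − (a+e)X + (ae − bc)`, the characteristic polynomial of `[[a,b],[c,e]]`) and `v(λ₀ − a) ≤ exp(2M + k − 2d)`: strong Hensel (★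
`exists_isRoot_of_v_eval_lt_sq`) for the INTEGRAL quadratic `f = X² − (a′+e′)X + (a′e′ − b′c′)`, `x′ = ϖ^M x`, at `a′` (`f(a′) = −b′c′`, `f′(a′) = a′ − e′`).
[cite: NeukirchANT1999, Ch. II §4 Lemma (4.6)] [cite: HarishChandra1970, Part VI §8 p. 60] -/
theorem exists_root_near_diagonal {ϖ : K} (hϖ : Valued.v ϖ = WithZero.exp (-1 : ℤ)) (a b c e : K) (M k d : ℕ) (hd : M + k < d)
    (ha : Valued.v a ≤ WithZero.exp (M : ℤ)) (hb : Valued.v b ≤ WithZero.exp ((M : ℤ) - 2 * d)) (hc : Valued.v c ≤ WithZero.exp (M : ℤ))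
    (he : Valued.v e ≤ WithZero.exp (M : ℤ)) (hsep : WithZero.exp (-(k : ℤ)) ≤ Valued.v (a - e)) :
    ∃ l₀ : K, (l₀ - a) * (l₀ - e) = b * c ∧ Valued.v (l₀ - a) ≤ WithZero.exp (2 * (M : ℤ) + k - 2 * d) := by
  classical
  obtain ⟨hvpinv, hp0⟩ := v_inv_pow_uniformizer hϖ M
  set p : K := ϖ ^ M with hp
  have hvp : Valued.v p = WithZero.exp (-(M : ℤ)) := by
    rw [hp, map_pow, hϖ, ← WithZero.exp_nsmul]; congr 1; simp
  -- rescaled entries are integral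
  have hint : ∀ {x : K}, Valued.v x ≤ WithZero.exp (M : ℤ) → Valued.v (p * x) ≤ 1 := by
    intro x hx
    rw [map_mul, hvp]
    calc WithZero.exp (-(M : ℤ)) * Valued.v x ≤ WithZero.exp (-(M : ℤ)) * WithZero.exp (M : ℤ) := mul_le_mul' le_rfl hx
      _ = 1 := by rw [← WithZero.exp_add, neg_add_cancel, WithZero.exp_zero]
  have hb' : Valued.v b ≤ WithZero.exp (M : ℤ) := hb.trans (WithZero.exp_le_exp.2 (by omega))
  obtain ⟨u, hu⟩ : ∃ u : K, u = p * a + p * e := ⟨_, rfl⟩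
  obtain ⟨w, hw⟩ : ∃ w : K, w = p * a * (p * e) - p * b * (p * c) := ⟨_, rfl⟩
  have h1 : Valued.v u ≤ 1 := by rw [hu]; exact Valuation.map_add_le _ (hint ha) (hint he)
  have h0 : Valued.v w ≤ 1 := by
    rw [hw]
    exact Valuation.map_sub_le _ (by rw [map_mul]; exact mul_le_one' (hint ha) (hint he)) (by rw [map_mul]; exact mul_le_one' (hint hb') (hint hc))
  obtain ⟨f, hf⟩ : ∃ f : K[X], f = X ^ 2 - C u * X + C w := ⟨_, rfl⟩
  have hcoef : ∀ n, Valued.v (f.coeff n) ≤ 1 := by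
    intro n
    rcases n with _ | _ | _ | n
    · simpa [hf] using h0
    · simpa [hf] using h1
    · simp [hf]
    · simp [hf]
  have hev : f.eval (p * a) = -(p * b * (p * c)) := by
    simp only [hf, hu, hw, eval_sub, eval_add, eval_mul, eval_pow, eval_C, eval_X]; ring
  have hder : f.derivative.eval (p * a) = p * (a - e) := by
    simp only [hf, hu, derivative_sub, derivative_add, derivative_X_sq, derivative_C_mul_X, derivative_C, eval_sub, eval_add, eval_mul, eval_C, eval_X,
      eval_zero]
    ring
  -- `v(f(a′)) ≤ exp(−2d) < exp(−2M − 2k) ≤ v(f′(a′))²`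
  have hlt : Valued.v (f.eval (p * a)) < Valued.v (f.derivative.eval (p * a)) ^ 2 := by
    rw [hev, hder, Valuation.map_neg, map_mul, map_mul, map_mul, map_mul, hvp]
    calc WithZero.exp (-(M : ℤ)) * Valued.v b * (WithZero.exp (-(M : ℤ)) * Valued.v c)
        ≤ WithZero.exp (-(M : ℤ)) * WithZero.exp ((M : ℤ) - 2 * d) * (WithZero.exp (-(M : ℤ)) * WithZero.exp (M : ℤ)) :=
          mul_le_mul' (mul_le_mul' le_rfl hb) (mul_le_mul' le_rfl hc)
      _ = WithZero.exp (-(2 * (d : ℤ))) := by rw [← WithZero.exp_add, ← WithZero.exp_add, ← WithZero.exp_add]; congr 1; ring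
      _ < WithZero.exp (-(M : ℤ) + -(k : ℤ)) ^ 2 := by rw [sq, ← WithZero.exp_add]; exact WithZero.exp_lt_exp.2 (by omega)
      _ ≤ (WithZero.exp (-(M : ℤ)) * Valued.v (a - e)) ^ 2 := by
          rw [WithZero.exp_add]
          exact pow_le_pow_left' (mul_le_mul' le_rfl hsep) 2
  obtain ⟨μ, hμ, hest⟩ := exists_isRoot_of_v_eval_lt_sq f hcoef (p * a) (hint ha) hlt
  refine ⟨p⁻¹ * μ, ?_, ?_⟩
  · -- the root identity, rescaled back
    have hroot : f.eval μ = 0 := hμ.eq_zero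
    simp only [hf, hu, hw, eval_sub, eval_add, eval_mul, eval_pow, eval_C, eval_X] at hroot
    have hμ' : μ = p * (p⁻¹ * μ) := by rw [← mul_assoc, mul_inv_cancel₀ hp0, one_mul]
    have key : p ^ 2 * ((p⁻¹ * μ - a) * (p⁻¹ * μ - e) - b * c) = 0 := by
      rw [← hroot]
      conv_rhs => rw [hμ']
      ring
    exact sub_eq_zero.1 ((mul_eq_zero.1 key).resolve_left (pow_ne_zero 2 hp0))
  · -- the estimate `v(λ₀ − a)·v(a − e) ≤ v(b)v(c)`, then divide by `v(a − e) ≥ exp(−k)`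
    rw [hev, hder, Valuation.map_neg] at hest
    have hμa : μ - p * a = p * (p⁻¹ * μ - a) := by rw [mul_sub, ← mul_assoc, mul_inv_cancel₀ hp0, one_mul]
    rw [hμa, map_mul, map_mul, map_mul, map_mul, map_mul] at hest
    -- cancel `v(p)²`
    have hvp0 : Valued.v p ≠ 0 := (Valuation.ne_zero_iff _).2 hp0
    have hcancel : Valued.v (p⁻¹ * μ - a) * Valued.v (a - e) ≤ Valued.v b * Valued.v c := by
      have h := mul_le_mul' (le_refl ((Valued.v p)⁻¹ * (Valued.v p)⁻¹)) hest
      calc Valued.v (p⁻¹ * μ - a) * Valued.v (a - e)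
          = (Valued.v p)⁻¹ * (Valued.v p)⁻¹ * (Valued.v p * Valued.v (p⁻¹ * μ - a) * (Valued.v p * Valued.v (a - e))) := by
            field_simp
        _ ≤ (Valued.v p)⁻¹ * (Valued.v p)⁻¹ * (Valued.v p * Valued.v b * (Valued.v p * Valued.v c)) := h
        _ = Valued.v b * Valued.v c := by field_simp
    have hbc : Valued.v b * Valued.v c ≤ WithZero.exp (2 * (M : ℤ) - 2 * d) := by
      calc Valued.v b * Valued.v c ≤ WithZero.exp ((M : ℤ) - 2 * d) * WithZero.exp (M : ℤ) := mul_le_mul' hb hc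
        _ = WithZero.exp (2 * (M : ℤ) - 2 * d) := by rw [← WithZero.exp_add]; congr 1; ring
    have hk : Valued.v (p⁻¹ * μ - a) * WithZero.exp (-(k : ℤ)) ≤ WithZero.exp (2 * (M : ℤ) - 2 * d) :=
      (mul_le_mul' le_rfl hsep).trans (hcancel.trans hbc)
    calc Valued.v (p⁻¹ * μ - a) = Valued.v (p⁻¹ * μ - a) * WithZero.exp (-(k : ℤ)) * WithZero.exp (k : ℤ) := by
          rw [mul_assoc, ← WithZero.exp_add, neg_add_cancel, WithZero.exp_zero, mul_one]
      _ ≤ WithZero.exp (2 * (M : ℤ) - 2 * d) * WithZero.exp (k : ℤ) := mul_le_mul' hk le_rfl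
      _ = WithZero.exp (2 * (M : ℤ) + k - 2 * d) := by rw [← WithZero.exp_add]; congr 1; ring

end Hensel

/-! ## §2 The root involution at `2 × 2` -/

section RootInvolution

variable {K : Type*} [Field K] (σ : K →+* K) {J : Matrix (Fin 2) (Fin 2) K} (hJ : J = (StdForm.antidiagonal 2).over K)

include hJ in
/-- **Trace and determinant of a unitary `2 × 2` matrix**: for `g ∈ U(σ, Φ₂)` with matrix `[[a,b],[c,e]]`, `σ(a + e)·(ae − bc) = a + e` and `σ(ae − bc)·(ae − bc) = 1` — from the
four relations `ᵗ(σA)Φ₂A = Φ₂` (★ `Two.rel00–rel11`) and the four relations `A·A⁻¹ = 1` with `(A⁻¹)ᵢⱼ = σ(A_{1−j,1−i})` (★ `Two.inv_apply_of_mem`).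
[cite: Rogawski1990, §1.9–§1.10 pp. 8–9] -/
theorem trace_det_rel (g : ↥(unitaryGroupOfForm σ J)) :
    (σ (((g : GL (Fin 2) K) : Matrix (Fin 2) (Fin 2) K) 0 0) + σ (((g : GL (Fin 2) K) : Matrix (Fin 2) (Fin 2) K) 1 1)) *
        (((g : GL (Fin 2) K) : Matrix (Fin 2) (Fin 2) K) 0 0 * ((g : GL (Fin 2) K) : Matrix (Fin 2) (Fin 2) K) 1 1 -
          ((g : GL (Fin 2) K) : Matrix (Fin 2) (Fin 2) K) 0 1 * ((g : GL (Fin 2) K) : Matrix (Fin 2) (Fin 2) K) 1 0) =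
        ((g : GL (Fin 2) K) : Matrix (Fin 2) (Fin 2) K) 0 0 + ((g : GL (Fin 2) K) : Matrix (Fin 2) (Fin 2) K) 1 1 ∧
      (σ (((g : GL (Fin 2) K) : Matrix (Fin 2) (Fin 2) K) 0 0) * σ (((g : GL (Fin 2) K) : Matrix (Fin 2) (Fin 2) K) 1 1) -
          σ (((g : GL (Fin 2) K) : Matrix (Fin 2) (Fin 2) K) 0 1) * σ (((g : GL (Fin 2) K) : Matrix (Fin 2) (Fin 2) K) 1 0)) *
        (((g : GL (Fin 2) K) : Matrix (Fin 2) (Fin 2) K) 0 0 * ((g : GL (Fin 2) K) : Matrix (Fin 2) (Fin 2) K) 1 1 -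
          ((g : GL (Fin 2) K) : Matrix (Fin 2) (Fin 2) K) 0 1 * ((g : GL (Fin 2) K) : Matrix (Fin 2) (Fin 2) K) 1 0) = 1 := by
  set A : Matrix (Fin 2) (Fin 2) K := ((g : GL (Fin 2) K) : Matrix (Fin 2) (Fin 2) K) with hA
  -- `A · A⁻¹ = 1`, with `(A⁻¹)ᵢⱼ = σ(A (rev j) (rev i))`
  have hmul : A * (((g : GL (Fin 2) K)⁻¹ : GL (Fin 2) K) : Matrix (Fin 2) (Fin 2) K) = 1 := by
    rw [hA, ← Units.val_mul, mul_inv_cancel, Units.val_one]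
  have hent : ∀ i j : Fin 2, A i 0 * σ (A (Fin.rev j) (Fin.rev 0)) + A i 1 * σ (A (Fin.rev j) (Fin.rev 1)) = (1 : Matrix (Fin 2) (Fin 2) K) i j := by
    intro i j
    have h := congrFun (congrFun hmul i) j
    rwa [Matrix.mul_apply, Fin.sum_univ_two, Two.inv_apply_of_mem σ hJ g, Two.inv_apply_of_mem σ hJ g, ← hA] at h
  have h00 := hent 0 0
  have h01 := hent 0 1
  have h10 := hent 1 0
  have h11 := hent 1 1
  simp only [Fin.isValue, show Fin.rev (0 : Fin 2) = 1 from rfl, show Fin.rev (1 : Fin 2) = 0 from rfl, Matrix.one_apply_eq,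
    Matrix.one_apply_ne (show (0 : Fin 2) ≠ 1 by decide), Matrix.one_apply_ne (show (1 : Fin 2) ≠ 0 by decide)] at h00 h01 h10 h11
  have r00 := Two.rel00 σ hJ g
  have r01 := Two.rel01 σ hJ g
  have r10 := Two.rel10 σ hJ g
  have r11 := Two.rel11 σ hJ g
  rw [← hA] at r00 r01 r10 r11
  have hp1 : (σ (A 0 0) * A 1 1 + σ (A 1 0) * A 0 1) * (σ (A 0 1) * A 1 0 + σ (A 1 1) * A 0 0) = 1 := by rw [r01, r10, mul_one]
  have hp0 : (σ (A 0 0) * A 1 0 + σ (A 1 0) * A 0 0) * (σ (A 0 1) * A 1 1 + σ (A 1 1) * A 0 1) = 0 := by rw [r00, zero_mul]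
  constructor
  · linear_combination A 1 1 * h00 + A 0 0 * h11 - A 0 1 * h10 - A 1 0 * h01
  · linear_combination hp1 - hp0

/-- **The root involution, `2 × 2`**: if `(λ₀ − a)(λ₀ − e) = bc` (a root of `χ_A`), `σ(tr A)·det A = tr A` and `σ(det A)·det A = 1`, then
`(σ(λ₀)λ₀ − 1)(σ(λ₀)(a + e − λ₀) − 1) = 0`: `σ(λ₀)` is a root of `χ_A^σ = χ_{A⁻¹}`, whose roots are `λ₀⁻¹` and `λ₁⁻¹ = (a + e − λ₀)⁻¹`. [cite: Rogawski1990, §3.5 p. 29] -/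
theorem sigma_root_mul_root_cases {a b c e l₀ : K}
    (hT : (σ a + σ e) * (a * e - b * c) = a + e) (hD : (σ a * σ e - σ b * σ c) * (a * e - b * c) = 1) (hroot : (l₀ - a) * (l₀ - e) = b * c) :
    (σ l₀ * l₀ - 1) * (σ l₀ * (a + e - l₀) - 1) = 0 := by
  have hσroot : (σ l₀ - σ a) * (σ l₀ - σ e) = σ b * σ c := by
    have h := congrArg σ hroot
    simpa only [map_mul, map_sub] using h
  linear_combination (-(σ l₀) ^ 2) * hroot + (a * e - b * c) * hσroot + σ l₀ * hT - hD

end RootInvolution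

end Summit.HodgeConjecture.HodgeConjecture.Cruxes.H413.K2E3NearTriangularEigenvaluesTwo

end
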